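import Literature.Geometry.Riemannian.ChangGurskyYangSpectral
import Literature.Geometry.Riemannian.ShiDerivativeMaxPrinciple
import Literature.Geometry.Lorentzian.HopfPositivity
import Literature.Geometry.Lorentzian.HessianLocalMax
import HarnessLib

/-!
# Chang–Gursky–Yang 2003, proof of Thm. 1.4, the minimum-principle step (p. 116):
# `Y(M,[g]) > 0` and `6 Δ_g R ≤ R²` force `R > 0` (Gursky's Lemma 1.2)

Sixth companion ("Proofs") file of `Literature/Geometry/Riemannian/ChangGurskyYang.lean`, in
support of the named fact `changGurskyYang_theorem14_four` (`ChangGurskyYangTheorem14.lean`: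
Chang–Gursky–Yang 2003, Thm. 1.4, the existence theorem for `σ₂(A_g) − ¼|W_g|² > 0` in a
conformal class with `Y > 0`). The printed proof of Thm. 1.4 (pp. 113–117) runs: the functional
`F = γ₁I + γ₂II + γ₃III` has a smooth extremal `g₁ = e^{2ω}g₀` at `δ = 1` (Thm. 1.5), whose Euler
equation, rewritten with (1.11) `Q = ½σ₂(A) − (1/12)ΔR`, is
(1.16) `σ₂(A) − (α/4)|W|² = ¼ΔR − 2γ̃₁|η|²` with `γ̃₁ < 0`; then, verbatim (p. 116),
*"Using the minimum principle of [Gu, Lemma 1.2], this implies that the scalar curvature of `g₁`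
is strictly positive"* — the ellipticity needed to start the continuity method in `δ` (the set
`S = {δ ∈ [δ₀,1] : (⋆)_δ admits a solution with positive scalar curvature}` contains `1`). The same
step closes the proof of Prop. 4.3 of Chang–Gursky–Yang 2002 (Ann. of Math. 155), *"Since `g`
satisfies `(∗)_δ`, the scalar curvature satisfies [`ΔR ≤ …`]. Thus, by the minimum principle,
`R > 0` on `M⁴`"*. This file PROVES that step on a closed connected Riemannian `4`-manifold, in
the tree's vocabulary (`dalembertian = tr_g Hess` the Laplace–Beltrami operator `Δ`,
`scalarCurvature = R`, `sigma2WeylSchouten = σ₂(A)`, `weylNormSq = |W|²`, `yamabeConstant = Y`):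

* `groundStateEigenvalue_pos_of_yamabeConstant_pos` — **the first eigenvalue of the conformal
  Laplacian is positive when `Y(M,[g]) > 0`**: if `φ > 0` is smooth with
  `−Δ_g φ + (R/6)φ = λφ` (i.e. `Lφ = 6λφ` for `L = −6Δ + R`), then `λ > 0` — the conformal metric
  `g' = φ²g` has `R_{g'} = φ⁻³(Rφ − 6Δφ) = 6λφ⁻²` (`scalarCurvature_conformal_sq_four`; Aubin 1982,
  Ch. 6, §6.3 (1)) and `∫R_{g'} dV_{g'} > 0` because `Y(M,[g']) = Y(M,[g]) > 0`
  (`integral_scalarCurvature_pos_of_yamabeConstant_pos`);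
* `scalarCurvature_pos_of_yamabeConstant_pos_of_dalembertian_le` — **the minimum principle**
  (Gursky 1998, Lemma 1.2, in the form used at p. 116): on a closed connected Riemannian
  `4`-manifold with `Y(M,[g]) > 0`, if `6Δ_g R ≤ R²` pointwise (`R` a supersolution of the
  conformal Laplacian, `LR = −6ΔR + R·R ≥ 0`), then `R > 0` everywhere. Proof: let `φ > 0` be the
  ground state of `−Δ + R/6` (`exists_pos_groundState`, `SchrodingerGroundState.lean`), `λ > 0` by
  the previous item. (i) `R ≥ 0`: at a minimum point `x₀` of `R/φ` with value `m < 0` the function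
  `F = R − mφ ≥ 0` vanishes, so `Δ_g F(x₀) ≥ 0` (`dalembertian_nonneg_of_isLocalMin`,
  `Lorentzian/HessianLocalMax.lean`) while `ΔF = ΔR − mΔφ` and `Δφ = (R/6 − λ)φ` give
  `6ΔR(x₀) ≥ R(x₀)² − 6λR(x₀)`; with `6ΔR ≤ R²` this is `λR(x₀) ≥ 0`, contradicting
  `R(x₀) = mφ(x₀) < 0`. (ii) `R > 0`: `Δ_g R ≤ (R/6)·R` with `R/6 ≥ 0`, so by E. Hopf's minimum
  principle on the connected manifold (`dalembertian_supersolution_eq_of_exists_eq`,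
  `Lorentzian/HopfPositivity.lean`; López-Gómez 2012, Thm. 1.2) a zero of `R` forces `R ≡ 0`,
  contradicting `∫R dV > 0`;
* `scalarCurvature_pos_of_changGurskyYang_eulerEquation` — **the sentence of p. 116 itself**: a
  metric `g` with `Y(M,[g]) > 0` satisfying (1.16),
  `σ₂(A_g) − (α/4)|W_g|² = ¼Δ_g R_g − 2γ̃₁ η²` with `α ≥ 0`, `γ̃₁ ≤ 0` and `η² ≥ 0` (the pointwise
  square norm `|η|²_g` of the auxiliary symmetric `2`-tensor, entering only through its sign), has
  `R_g > 0`: for `¼ΔR = σ₂(A) − (α/4)|W|² + 2γ̃₁η² ≤ σ₂(A) = −½|E|² + R²/24 ≤ R²/24`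
  (`sigma2WeylSchouten_eq`), i.e. `6ΔR ≤ R²`;
* `scalarCurvature_pos_of_changGurskyYang_eulerEquation_of_isConformalTo` — the same with the
  hypothesis `Y(M,[g₀]) > 0` on a conformal metric `g₀` (hypothesis (i) of Thm. 1.4; `Y` is a
  conformal invariant, `yamabeConstant_eq_of_isConformalTo`), for the extremal `g₁ ∈ [g₀]`.

Everything is proved; no definition and no named fact is introduced. Not here: the existence of
the extremal (Thm. 1.5), the continuity method and Thm. 1.6 — the analytic core of Thm. 1.4.

## References

* S.-Y. A. Chang, M. J. Gursky, P. C. Yang, *A conformally invariant sphere theorem in four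
  dimensions*, Publ. Math. IHÉS 98 (2003) 105–143, §1: (1.11) p. 113, (1.13) p. 114, (1.16) and
  the sentence following it, p. 116. [ChangGurskyYang2003]
* S.-Y. A. Chang, M. J. Gursky, P. C. Yang, *An equation of Monge–Ampère type in conformal
  geometry, and four-manifolds of positive Ricci curvature*, Ann. of Math. 155 (2002) 709–787,
  end of the proof of Prop. 4.3 ("by the minimum principle, `R > 0`"). [ChangGurskyYang2002]
* M. J. Gursky, *The Weyl functional, de Rham cohomology, and Kähler–Einstein metrics*, Ann. of
  Math. 148 (1998) 315–337, Lemma 1.2. [Gursky1998]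
* J. López-Gómez, *Linear Second Order Elliptic Operators*, World Scientific (2012/2013), Ch. 1,
  Thm. 1.2 (through `Lorentzian/HopfPositivity.lean`). [LopezGomez2012]
* T. Aubin, *Nonlinear Analysis on Manifolds. Monge–Ampère Equations*, Springer 1982, Ch. 6,
  §6.3 (1) and Thm. 6.5 (α) (through `SchrodingerGroundState.lean`,
  `Lorentzian/ConformalChangeFour.lean`). [Aubin1982]
-/

noncomputable section

open Bundle Set Function Filter Manifold MeasureTheory Module
open scoped Manifold ContDiff Topology ENNReal

namespace Literature.Geometry.Riemannian

open Literature.Geometry.Lorentzian (PseudoRiemannianMetric riemannianMeasure)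
open Literature.Geometry.Lorentzian.PseudoRiemannianMetric
open Literature.Geometry.Lorentzian

section MinimumPrinciple

variable {M : Type*} [TopologicalSpace M] [T2Space M] [CompactSpace M]
  [ChartedSpace (EuclideanSpace ℝ (Fin 4)) M] [IsManifold (𝓡 4) ∞ M]
  [MeasurableSpace M] [BorelSpace M]
  (g : PseudoRiemannianMetric (𝓡 4) ∞ (EuclideanSpace ℝ (Fin 4)) (TangentSpace (𝓡 4) : M → Type _))
  [g.HasLeviCivita]

/-- **The first eigenvalue of the conformal Laplacian is positive in a class with `Y > 0`.** On a
closed Riemannian `4`-manifold with `Y(M,[g]) > 0`, a smooth `φ > 0` with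
`−Δ_g φ + (R_g/6) φ = λ φ` has `λ > 0`: the conformal metric `g' = φ² g` has scalar curvature
`R_{g'} = φ⁻³(R_g φ − 6Δ_g φ) = 6λ φ⁻²` (Aubin 1982, Ch. 6, §6.3, eq. (1), `n = 4`), and
`Y(M,[g']) = Y(M,[g]) > 0` forces `∫ R_{g'} dV_{g'} > 0`. (The step isolated from
`exists_conformal_sq_scalarCurvature_pos_of_yamabeConstant_pos` of `ChangGurskyYangSpectral.lean`;
Aubin 1982, Thm. 6.5 (α): "the positive case `μ > 0`".) [cite: Aubin1982, Ch. 6, Thm. 6.5 (α), (4)]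
[cite: LeeParker1987, §1, (1.5)] -/
theorem groundStateEigenvalue_pos_of_yamabeConstant_pos (hg : g.IsRiemannian)
    (hY : 0 < yamabeConstant (g.toContMDiffRiemannianMetric hg)) {φ : M → ℝ} {ev : ℝ}
    (hφ : ContMDiff (𝓡 4) 𝓘(ℝ) ∞ φ) (hpos : ∀ x, 0 < φ x)
    (heq : ∀ x, -g.dalembertian φ x + 1 / 6 * g.scalarCurvature x * φ x = ev * φ x) :
    0 < ev := by
  have hE : finrank ℝ (EuclideanSpace ℝ (Fin 4)) = 4 := finrank_euclideanSpace_fin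
  obtain ⟨g', hg'R, hval⟩ := exists_conformal_sq g hg hφ hpos
  haveI hLC' : g'.HasLeviCivita := g'.hasLeviCivita
  -- `R_{g'} = φ⁻³ (Rφ − 6Δφ) = 6 λ φ⁻²`
  have hR' : ∀ x, g'.scalarCurvature x = 6 * ev * (φ x ^ 2)⁻¹ := by
    intro x
    have hx : φ x ≠ 0 := (hpos x).ne'
    have key : g.scalarCurvature x * φ x - 6 * g.dalembertian φ x = 6 * ev * φ x := by
      linear_combination 6 * heq x
    rw [scalarCurvature_conformal_sq_four hE g g' hφ hpos hval x, key]
    field_simp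
  -- `Y(M,[g']) = Y(M,[g]) > 0` forces `∫ R_{g'} dV_{g'} > 0`, hence `λ > 0`
  have hconf : IsConformalTo (g'.toContMDiffRiemannianMetric hg'R)
      (g.toContMDiffRiemannianMetric hg) :=
    ⟨fun x ↦ φ x ^ 2, fun x ↦ ⟨pow_pos (hpos x) 2, fun v w ↦ hval x v w⟩⟩
  have hY' : 0 < yamabeConstant (g'.toContMDiffRiemannianMetric hg'R) := by
    rwa [yamabeConstant_eq_of_isConformalTo hconf]
  by_contra hev
  push Not at hev
  have hle : ∀ x, g'.scalarCurvature x ≤ 0 := fun x ↦ by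
    rw [hR' x]
    exact mul_nonpos_of_nonpos_of_nonneg (by linarith) (inv_nonneg.2 (sq_nonneg _))
  exact absurd (g'.integral_scalarCurvature_pos_of_yamabeConstant_pos hg'R hY')
    (not_lt.2 (integral_nonpos hle))

/-- **The minimum principle of Gursky (1998, Lemma 1.2), as used in the proof of
Chang–Gursky–Yang 2003, Thm. 1.4 (p. 116): on a closed connected Riemannian `4`-manifold with
`Y(M,[g]) > 0`, if the scalar curvature satisfies `6 Δ_g R ≤ R²` pointwise — i.e. `R` is a
supersolution of the conformal Laplacian, `L R = −6Δ_g R + R·R ≥ 0` — then `R > 0` everywhere.**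
Proof. Let `φ > 0` be the smooth ground state of `−Δ_g + R/6`, `−Δφ + (R/6)φ = λφ`
(`exists_pos_groundState`); `λ > 0` (`groundStateEigenvalue_pos_of_yamabeConstant_pos`).
(i) `R ≥ 0`: if the minimum `m` of `R/φ`, attained at `x₀`, were negative, then
`F = R − mφ ≥ 0` with `F(x₀) = 0`, so `Δ_g F(x₀) ≥ 0` (`dalembertian_nonneg_of_isLocalMin`), and
`ΔF = ΔR − mΔφ`, `Δφ = (R/6 − λ)φ`, `mφ(x₀) = R(x₀)` give `6ΔR(x₀) ≥ R(x₀)² − 6λR(x₀)`; with the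
hypothesis, `λ R(x₀) ≥ 0`, contradicting `R(x₀) = mφ(x₀) < 0`. (ii) `R > 0`: now
`Δ_g R ≤ (R/6) R` with `R/6 ≥ 0` continuous, so by E. Hopf's minimum principle on the connected
manifold (`dalembertian_supersolution_eq_of_exists_eq`; López-Gómez 2012, Thm. 1.2) a zero of `R`
would force `R ≡ 0`, contradicting `∫ R dV > 0`
(`integral_scalarCurvature_pos_of_yamabeConstant_pos`). [cite: ChangGurskyYang2003, §1, p. 116]
[cite: Gursky1998, Lemma 1.2] [cite: ChangGurskyYang2002, proof of Prop. 4.3]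
[cite: LopezGomez2012, Thm. 1.2] -/
theorem scalarCurvature_pos_of_yamabeConstant_pos_of_dalembertian_le [ConnectedSpace M]
    (hg : g.IsRiemannian) (hY : 0 < yamabeConstant (g.toContMDiffRiemannianMetric hg))
    (hΔ : ∀ x, 6 * g.dalembertian g.scalarCurvature x ≤ g.scalarCurvature x ^ 2) (x : M) :
    0 < g.scalarCurvature x := by
  classical
  have hRs : ContMDiff (𝓡 4) 𝓘(ℝ, ℝ) ∞ g.scalarCurvature := g.contMDiff_scalarCurvature
  have hR2 : ContMDiff (𝓡 4) 𝓘(ℝ, ℝ) 2 g.scalarCurvature :=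
    hRs.of_le (WithTop.coe_le_coe.mpr le_top)
  -- the ground state of `−Δ + R/6` and its positive eigenvalue
  have hV : ContMDiff (𝓡 4) 𝓘(ℝ) ∞ fun x ↦ (1 / 6 : ℝ) * g.scalarCurvature x :=
    contMDiff_const.mul g.contMDiff_scalarCurvature
  obtain ⟨φ, ev, hφ, hpos, heq, -⟩ := exists_pos_groundState g (by norm_num) hg hV
  have hev : 0 < ev := groundStateEigenvalue_pos_of_yamabeConstant_pos g hg hY hφ hpos heq
  have hφ2 : ContMDiff (𝓡 4) 𝓘(ℝ, ℝ) 2 φ := hφ.of_le (WithTop.coe_le_coe.mpr le_top)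
  have hΔφ : ∀ y, g.dalembertian φ y = (1 / 6 * g.scalarCurvature y - ev) * φ y := fun y ↦ by
    linear_combination -(heq y)
  -- (i) `R ≥ 0`
  have hnonneg : ∀ y, 0 ≤ g.scalarCurvature y := by
    -- the minimum `m` of `R/φ`, attained at `x₀`
    obtain ⟨x₀, -, hx₀⟩ := isCompact_univ.exists_isMinOn univ_nonempty
      ((hRs.continuous.div hφ.continuous fun y ↦ (hpos y).ne')).continuousOn
    set m : ℝ := g.scalarCurvature x₀ / φ x₀ with hm
    have hmle : ∀ y, m * φ y ≤ g.scalarCurvature y := fun y ↦ by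
      have hy : m ≤ g.scalarCurvature y / φ y := hx₀ (mem_univ y)
      rwa [le_div_iff₀ (hpos y)] at hy
    have hRx₀ : g.scalarCurvature x₀ = m * φ x₀ := by
      rw [hm]; field_simp [(hpos x₀).ne']
    by_contra hneg
    push Not at hneg
    obtain ⟨x₁, hx₁⟩ := hneg
    have hm_neg : m < 0 := by
      by_contra hm0
      push Not at hm0
      exact absurd ((mul_nonneg hm0 (hpos x₁).le).trans (hmle x₁)) (not_le.2 hx₁)
    -- `F = R − m φ ≥ 0` vanishes at `x₀`
    set F : M → ℝ := fun y ↦ g.scalarCurvature y + (-m) * φ y with hF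
    have hFmin : IsMinOn F univ x₀ := by
      intro y _
      show g.scalarCurvature x₀ + (-m) * φ x₀ ≤ g.scalarCurvature y + (-m) * φ y
      have := hmle y
      rw [hRx₀]
      linarith
    have hFloc : IsLocalMin F x₀ := hFmin.isLocalMin univ_mem
    have hF2 : ContMDiffAt (𝓡 4) 𝓘(ℝ, ℝ) 2 F x₀ :=
      (hR2 x₀).add (contMDiffAt_const.mul (hφ2 x₀))
    -- `Δ F (x₀) ≥ 0` and `Δ F = Δ R − m Δ φ`
    have hΔF : 0 ≤ g.dalembertian F x₀ :=
      g.dalembertian_nonneg_of_isLocalMin hF2 hFloc fun v hv ↦ hg x₀ v hv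
    have hlin : g.dalembertian F x₀ =
        g.dalembertian g.scalarCurvature x₀ + (-m) * g.dalembertian φ x₀ :=
      dalembertian_add_const_mul g (-m) (hR2 x₀) (hφ2 x₀)
    rw [hlin, hΔφ x₀] at hΔF
    have hkey : (-m) * ((1 / 6 * g.scalarCurvature x₀ - ev) * φ x₀) =
        -(1 / 6) * g.scalarCurvature x₀ ^ 2 + ev * g.scalarCurvature x₀ := by
      rw [hRx₀]; ring
    rw [hkey] at hΔF
    have h1 := hΔ x₀
    have hRneg : g.scalarCurvature x₀ < 0 := by
      rw [hRx₀]; exact mul_neg_of_neg_of_pos hm_neg (hpos x₀)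
    have h2 : ev * g.scalarCurvature x₀ < 0 := mul_neg_of_pos_of_neg hev hRneg
    linarith
  -- (ii) `R > 0`: a zero would propagate by E. Hopf's minimum principle
  refine g.scalarCurvature_pos_of_yamabeConstant_pos hg hY (fun x₀ hx₀ ↦ ?_) x
  have hc : Continuous fun y ↦ g.scalarCurvature y / 6 := hRs.continuous.div_const 6
  have hpde : ∀ y, g.dalembertian g.scalarCurvature y ≤
      g.scalarCurvature y / 6 * g.scalarCurvature y := fun y ↦ by
    have h := hΔ y
    have h' : g.scalarCurvature y / 6 * g.scalarCurvature y = g.scalarCurvature y ^ 2 / 6 := by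
      ring
    rw [h']
    linarith
  have hall := g.dalembertian_supersolution_eq_of_exists_eq hg hc
    (fun y ↦ div_nonneg (hnonneg y) (by norm_num)) hR2 hpde le_rfl hnonneg hx₀
  have hint := g.integral_scalarCurvature_pos_of_yamabeConstant_pos hg hY
  have hzero : ∫ y, g.scalarCurvature y ∂(riemannianMeasure (g.toContMDiffRiemannianMetric hg)) = 0 := by
    simp_rw [hall]
    exact integral_zero _ _
  linarith

/-- **Chang–Gursky–Yang 2003, p. 116: "Using the minimum principle of [Gu, Lemma 1.2], this
implies that the scalar curvature of `g₁` is strictly positive."** Let `g` be a `C^∞` Riemannian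
metric on a closed connected `4`-manifold with `Y(M,[g]) > 0` satisfying the Euler equation (1.16)
of the functional `F` at `δ = 1`,
`σ₂(A_g) − (α/4)|W_g|² = ¼ Δ_g R_g − 2γ̃₁ η²` pointwise, with `α ≥ 0`, `γ̃₁ ≤ 0` (in the paper
`γ̃₁ < 0`, p. 115) and `η² ≥ 0` — `η²` is the square norm `|η|²_g` of the nowhere-vanishing
symmetric `2`-tensor `η` of the functional `Ĩ`, of which only the sign enters. Then `R_g > 0`:
indeed `¼ΔR = σ₂(A) − (α/4)|W|² + 2γ̃₁η² ≤ σ₂(A) = −½|E|² + R²/24 ≤ R²/24`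
(`sigma2WeylSchouten_eq`, `weylNormSq_nonneg`, `tracelessRicciNormSq_nonneg`), so `6ΔR ≤ R²`
and `scalarCurvature_pos_of_yamabeConstant_pos_of_dalembertian_le` applies.
[cite: ChangGurskyYang2003, §1, (1.16), p. 116] [cite: Gursky1998, Lemma 1.2] -/
theorem scalarCurvature_pos_of_changGurskyYang_eulerEquation [ConnectedSpace M]
    (hg : g.IsRiemannian) (hY : 0 < yamabeConstant (g.toContMDiffRiemannianMetric hg))
    {α γ₁ : ℝ} (hα : 0 ≤ α) (hγ₁ : γ₁ ≤ 0) {ηSq : M → ℝ} (hη : ∀ x, 0 ≤ ηSq x)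
    (h116 : ∀ x, g.sigma2WeylSchouten x - α / 4 * g.weylNormSq x =
      1 / 4 * g.dalembertian g.scalarCurvature x - 2 * γ₁ * ηSq x) (x : M) :
    0 < g.scalarCurvature x := by
  refine scalarCurvature_pos_of_yamabeConstant_pos_of_dalembertian_le g hg hY (fun y ↦ ?_) x
  have hσ := g.sigma2WeylSchouten_eq (WithTop.coe_le_coe.mpr le_top) finrank_euclideanSpace_fin
    (hg y)
  have hW := g.weylNormSq_nonneg y
  have hE := g.tracelessRicciNormSq_nonneg y
  have h := h116 y
  nlinarith [mul_nonneg hα hW, mul_nonneg (neg_nonneg.2 hγ₁) (hη y)]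

/-- **The same step in the setting of Thm. 1.4**: hypothesis (i) `Y(M⁴,[g₀]) > 0` is on the
background metric `g₀` and the Euler equation (1.16) holds for the extremal `g₁ = e^{2ω} g₀` of the
same conformal class; since `Y` is a conformal invariant (`yamabeConstant_eq_of_isConformalTo`),
`R_{g₁} > 0`. [cite: ChangGurskyYang2003, §1, Thm. 1.4 (i) and p. 116] [cite: Gursky1998, Lemma 1.2] -/
theorem scalarCurvature_pos_of_changGurskyYang_eulerEquation_of_isConformalTo [ConnectedSpace M]
    (g₀ : PseudoRiemannianMetric (𝓡 4) ∞ (EuclideanSpace ℝ (Fin 4)) (TangentSpace (𝓡 4) : M → Type _))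
    [g₀.HasLeviCivita] (hg₀ : g₀.IsRiemannian) (hg : g.IsRiemannian)
    (hconf : IsConformalTo (g.toContMDiffRiemannianMetric hg) (g₀.toContMDiffRiemannianMetric hg₀))
    (hY : 0 < yamabeConstant (g₀.toContMDiffRiemannianMetric hg₀))
    {α γ₁ : ℝ} (hα : 0 ≤ α) (hγ₁ : γ₁ ≤ 0) {ηSq : M → ℝ} (hη : ∀ x, 0 ≤ ηSq x)
    (h116 : ∀ x, g.sigma2WeylSchouten x - α / 4 * g.weylNormSq x =
      1 / 4 * g.dalembertian g.scalarCurvature x - 2 * γ₁ * ηSq x) (x : M) :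
    0 < g.scalarCurvature x := by
  rw [← yamabeConstant_eq_of_isConformalTo hconf] at hY
  exact scalarCurvature_pos_of_changGurskyYang_eulerEquation g hg hY hα hγ₁ hη h116 x

/-! ### The positivity step in the closedness of `S` (p. 116; Chang–Gursky–Yang 2002, Prop. 4.3) -/

/-- **E. Hopf's alternative for the scalar curvature**: on a closed connected Riemannian
`4`-manifold with `Y(M,[g]) > 0`, if `R_g ≥ 0` and `Δ_g R ≤ q · R` for a continuous `q ≥ 0`, then
`R_g > 0` everywhere — a zero of `R` would propagate to `R ≡ 0` by E. Hopf's minimum principle on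
the connected manifold (`dalembertian_supersolution_eq_of_exists_eq`; López-Gómez 2012, Thm. 1.2),
contradicting `∫R dV > 0` (`integral_scalarCurvature_pos_of_yamabeConstant_pos`). This is step (ii)
of `scalarCurvature_pos_of_yamabeConstant_pos_of_dalembertian_le` in isolation, the form in which
the minimum principle enters the CLOSEDNESS of the set `S` of the continuity method
(Chang–Gursky–Yang 2003, p. 116: "the estimates of Section 3 in [CGY1] can be used to show that
`S` is closed"; Chang–Gursky–Yang 2002, end of the proof of Prop. 4.3: the limit metric has `R ≥ 0`,
"Since `g` satisfies `(∗)_δ`, the scalar curvature satisfies [a differential inequality]. Thus, by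
the minimum principle, `R > 0` on `M⁴`"). [cite: ChangGurskyYang2002, proof of Prop. 4.3]
[cite: ChangGurskyYang2003, §1, p. 116] [cite: LopezGomez2012, Thm. 1.2] -/
theorem scalarCurvature_pos_of_nonneg_of_dalembertian_le_mul [ConnectedSpace M]
    (hg : g.IsRiemannian) (hY : 0 < yamabeConstant (g.toContMDiffRiemannianMetric hg))
    (hR0 : ∀ x, 0 ≤ g.scalarCurvature x) {q : M → ℝ} (hq : Continuous q) (hq0 : ∀ x, 0 ≤ q x)
    (hΔ : ∀ x, g.dalembertian g.scalarCurvature x ≤ q x * g.scalarCurvature x) (x : M) :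
    0 < g.scalarCurvature x := by
  have hR2 : ContMDiff (𝓡 4) 𝓘(ℝ, ℝ) 2 g.scalarCurvature :=
    g.contMDiff_scalarCurvature.of_le (WithTop.coe_le_coe.mpr le_top)
  refine g.scalarCurvature_pos_of_yamabeConstant_pos hg hY (fun x₀ hx₀ ↦ ?_) x
  have hall := g.dalembertian_supersolution_eq_of_exists_eq hg hq hq0 hR2 hΔ le_rfl hR0 hx₀
  have hint := g.integral_scalarCurvature_pos_of_yamabeConstant_pos hg hY
  have hzero : ∫ y, g.scalarCurvature y ∂(riemannianMeasure (g.toContMDiffRiemannianMetric hg)) = 0 := by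
    simp_rw [hall]
    exact integral_zero _ _
  linarith

/-- **Positivity of the scalar curvature of a limit of solutions of `(⋆)_δ`** (Chang–Gursky–Yang
2003, p. 116, closedness of `S`; Chang–Gursky–Yang 2002, end of the proof of Prop. 4.3): let `g` be
a `C^∞` Riemannian metric on a closed connected `4`-manifold with `Y(M,[g]) > 0` and `R_g ≥ 0` (as
for a limit of metrics of positive scalar curvature) satisfying the regularised equation
`(⋆)_δ`: `σ₂(A_g) − (α/4)|W_g|² = (δ/4)Δ_g R_g − 2γ̃₁ η²` with `δ > 0`, `α ≥ 0`, `γ̃₁ ≤ 0`, `η² ≥ 0`.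
Then `R_g > 0`: the equation gives `(δ/4)ΔR ≤ σ₂(A) ≤ R²/24`, i.e. `ΔR ≤ (R/(6δ))·R` with the
continuous multiplier `R/(6δ) ≥ 0`, and `scalarCurvature_pos_of_nonneg_of_dalembertian_le_mul`
applies. [cite: ChangGurskyYang2003, §1, (⋆)_δ, p. 116] [cite: ChangGurskyYang2002, proof of Prop. 4.3] -/
theorem scalarCurvature_pos_of_nonneg_of_changGurskyYang_deltaEquation [ConnectedSpace M]
    (hg : g.IsRiemannian) (hY : 0 < yamabeConstant (g.toContMDiffRiemannianMetric hg))
    (hR0 : ∀ x, 0 ≤ g.scalarCurvature x) {δ α γ₁ : ℝ} (hδ : 0 < δ) (hα : 0 ≤ α) (hγ₁ : γ₁ ≤ 0)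
    {ηSq : M → ℝ} (hη : ∀ x, 0 ≤ ηSq x)
    (hstar : ∀ x, g.sigma2WeylSchouten x - α / 4 * g.weylNormSq x =
      δ / 4 * g.dalembertian g.scalarCurvature x - 2 * γ₁ * ηSq x) (x : M) :
    0 < g.scalarCurvature x := by
  have hq : Continuous fun y ↦ g.scalarCurvature y / (6 * δ) :=
    g.contMDiff_scalarCurvature.continuous.div_const _
  refine scalarCurvature_pos_of_nonneg_of_dalembertian_le_mul g hg hY hR0 hq
    (fun y ↦ div_nonneg (hR0 y) (by positivity)) (fun y ↦ ?_) x
  have hσ := g.sigma2WeylSchouten_eq (WithTop.coe_le_coe.mpr le_top) finrank_euclideanSpace_fin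
    (hg y)
  have hW := g.weylNormSq_nonneg y
  have hE := g.tracelessRicciNormSq_nonneg y
  have h := hstar y
  -- `(δ/4) ΔR ≤ σ₂(A) ≤ R²/24`, i.e. `δ ΔR ≤ R²/6`
  have h1 : δ * g.dalembertian g.scalarCurvature y ≤ g.scalarCurvature y ^ 2 / 6 := by
    nlinarith [mul_nonneg hα hW, mul_nonneg (neg_nonneg.2 hγ₁) (hη y)]
  rw [show g.scalarCurvature y / (6 * δ) * g.scalarCurvature y = g.scalarCurvature y ^ 2 / 6 / δ by
    field_simp]
  rw [le_div_iff₀ hδ, mul_comm]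
  exact h1

end MinimumPrinciple

end Literature.Geometry.Riemannian

end
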